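import Literature.Analysis.FluidPDE.NSCriticalClosureBesov
import Literature.Analysis.FluidPDE.CriticalSpacesProofs
import Literature.Analysis.FluidPDE.CheskidovShvydkoy
import Literature.Analysis.FunctionSpaces.LittlewoodPaleyBernsteinProofs
import Literature.Analysis.FunctionSpaces.LittlewoodPaleyHomogeneousProofs
import Literature.Analysis.FunctionSpaces.PlancherelL1L2
import Literature.Analysis.FunctionSpaces.BMOBesovProofs
import Mathlib.Analysis.Calculus.LineDeriv.IntegrationByParts
import HarnessLib

/-!
# The critical Besov continuation criterion — proofs: the two Littlewood–Paley facts

Sibling proof file of `Literature/Analysis/FluidPDE/NSCriticalClosureBesov.lean`. It **discharges**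
two of the three identification facts of the assembly
`Literature.Analysis.FluidPDE.hasSmoothExtensionPast_of_eHomBesovNorm_bounded_of_gkp`:

* `Literature.Analysis.FluidPDE.tendsto_lowFreqCutoff_of_memLp_two` (Bahouri–Chemin–Danchin 2011, Def. 1.26 of `𝓢'_h`
  with the first of the Examples, p. 22: a tempered distribution whose Fourier transform is
  locally integrable near `0` — e.g. an `L²` function — belongs to `𝓢'_h`, i.e.
  `‖θ(λD)u‖_{L^∞} → 0` as `λ → ∞`) — `tendsto_lowFreqCutoff_of_memLp_two_holds`;
* `Literature.Analysis.FluidPDE.eHomBesovNorm_le_of_sobolev_one` (BCD Lemma 2.1 + Prop. 2.20 + Prop. 1.32: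
  `‖W‖_{Ḃ^{-1+3/p}_{p,q}} ≤ C ‖f‖_{L²}^{1/2} ‖∇f‖_{L²}^{1/2}` for `C¹` fields `f ∈ L²(ℝ³; ℝ³)`,
  `2 ≤ p < ∞`, `2 ≤ q`) — `eHomBesovNorm_le_of_sobolev_one_holds`.

## The proof (`tendsto_lowFreqCutoff_of_memLp_two_holds`)

Let `f ∈ L²(ℝ³; ℝ³)` with distribution `W` (`NS.IsDistributionOf`). By uniqueness of the
distribution of a field and `NS.isDistributionOf_toTemperedDistribution`, `W` is Mathlib's
tempered distribution of the `L²` class `g` of `complexify ∘ f`. The symbol `χ(2^{-j}·)` of the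
low-frequency cutoff `Ṡ_j` is a compactly supported smooth function, hence a Schwartz function
`Ψ_j` (Mathlib `HasCompactSupport.toSchwartzMap`), and Fourier multipliers with Schwartz symbol
act on `L^p` classes by convolution with `𝓕⁻¹Ψ_j`
(`Literature.Analysis.FunctionSpaces.fourierMultiplierCLM_coe_apply_eq_integral_convolution`): for every Schwartz `u`,
`⟨Ṡ_j W, u⟩ = ∫ u(y) • ((𝓕⁻¹Ψ_j) ⋆ g)(y) dy`. Cauchy–Schwarz in the convolution
(`Literature.Analysis.FunctionSpaces.enorm_convolution_smul_le_eLpNorm_mul`) bounds `‖((𝓕⁻¹Ψ_j) ⋆ g)(y)‖ ≤ ‖𝓕⁻¹Ψ_j‖₂ ‖g‖₂`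
uniformly in `y`, and by Plancherel (`Literature.Analysis.FunctionSpaces.eLpNorm_fourierIntegral_eq`, `𝓕 𝓕⁻¹ Ψ_j = Ψ_j`) and
the substitution `ξ = 2^{j} η`, `‖𝓕⁻¹Ψ_j‖₂ = ‖Ψ_j‖₂ = 2^{3j/2} ‖Ψ_0‖₂`. Hence
`|⟨Ṡ_j W, u⟩| ≤ 2^{3j/2} ‖Ψ_0‖₂ ‖g‖₂ ‖u‖_{L¹} → 0` as `j → -∞`, for every `u` — which is
convergence `Ṡ_j W → 0` in `𝓢'` (Mathlib's tempered distributions carry the topology of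
pointwise convergence, `PointwiseConvergenceCLM.tendsto_iff_forall_tendsto`).

## The proof (`eHomBesovNorm_le_of_sobolev_one_holds`)

Block by block, as in BCD (proof of Prop. 2.20 with Lemma 2.1, and the interpolation
Prop. 1.32): the Besov embedding `Ḃ^{1/2}_{2,q} ↪ Ḃ^{-1+3/p}_{p,q}` (`2 ≤ p`) is the discharged
`Literature.Analysis.FunctionSpaces.besov_embedding_holds`, and `‖·‖_{Ḃ^{1/2}_{2,q}} ≤ ‖·‖_{Ḃ^{1/2}_{2,1}}` for `1 ≤ q`
(`Literature.Analysis.FluidPDE.eHomBesovNorm_exponent_antitone`), so everything reduces to the multiplicative bound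
`‖W‖_{Ḃ^{1/2}_{2,1}} ≤ K ‖f‖_{L²}^{1/2} ‖Df‖_{L²}^{1/2}`
(`Literature.Analysis.FluidPDE.exists_eHomBesovNorm_half_le_sqrt_mul_sqrt`, i.e. `H¹ ⊂ Ḃ^{1/2}_{2,1}`). Its weights
`2^{j/2} ‖Δ̇_j W‖_{L²}` are bounded in two ways:

* `‖Δ̇_j W‖_{L²} ≤ C ‖f‖_{L²}` — the blocks are uniformly bounded on `L^p`
  (`Literature.Analysis.FluidPDE.exists_eLpNormDistrib_lpBlock_le_eLpNormDistrib`, from the low-frequency Bernstein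
  inequality `Literature.Analysis.FluidPDE.exists_eLpNormDistrib_lowFreqCutoff_le` and `Δ̇_j = Ṡ_j - Ṡ_{j-1}`);
* `‖Δ̇_j W‖_{L²} ≤ C 2^{-j} ∑_i ‖∂_i f‖_{L²}` — the **reverse Bernstein inequality** BCD Lemma 2.1
  (`k = 1`), proved here as `Literature.Analysis.FluidPDE.exists_eLpNormDistrib_lpBlock_le_sum_lineDeriv`:
  `Δ̇_j = ∑_i σ_{i,j}(D) ⟪D, b_i⟫ Δ̇_j` with the degree `-1` block-truncated symbols
  `σ_{i,j}(ξ) = (⟪ξ, b_i⟫/‖ξ‖²) ψ(2^{-j}ξ)` (`Literature.Analysis.FunctionSpaces.truncSymbol`), to which BCD Lemma 2.2 on the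
  blocks applies (`Literature.Analysis.FunctionSpaces.exists_eLpNormDistrib_truncSymbol_lpBlock_le_of_homogeneous`), and
  `⟪D, b_i⟫ = (2πi)⁻¹ ∂_{b_i}` (Mathlib's `TemperedDistribution.lineDeriv_eq_fourierMultiplierCLM`);
  the distributional derivatives `∂_{b_i} W` are the distributions of the classical partial
  derivatives `x ↦ Df(x) b_i ∈ L²` (`Literature.Analysis.FluidPDE.IsDistributionOf.lineDeriv`, integration by parts
  against Schwartz functions, Mathlib's
  `integral_bilinear_hasFDerivAt_right_eq_neg_left_of_integrable`).

Finally `∑_j min(2^{j/2} A, 2^{-j/2} B) ≤ K √A √B` (`Literature.Analysis.FluidPDE.exists_tsum_le_sqrt_mul_sqrt`: split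
at `2^{j₀} ≈ B/A`, two geometric series) — the dyadic form of the interpolation inequality
`‖f‖_{Ḣ^{1/2}} ≤ ‖f‖_{L²}^{1/2} ‖f‖_{Ḣ¹}^{1/2}` of BCD Prop. 1.32.

## References

* H. Bahouri, J.-Y. Chemin, R. Danchin, *Fourier Analysis and Nonlinear PDE*, Grundlehren 343
  (2011): Def. 1.26 and Examples (p. 22); Lemma 2.1 (Bernstein, direct and reverse), Lemma 2.2,
  Def. 2.15, Prop. 2.20 (Besov embedding), Prop. 1.32 (interpolation in `Ḣ^s`).
* R. Danchin, *Fourier analysis methods for the compressible Navier–Stokes equations* (2018;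
  arXiv:1507.02637), §2.1, p. 4: Prop. 2.1 (Bernstein inequalities, direct and reverse), the
  uniform `L^p` bounds on `Δ̇_j`, `Ṡ_j`, and the interpolation inequality
  `‖u‖_{Ḃ^{θs₂+(1-θ)s₁}_{p,r}} ≲ ‖u‖^{1-θ}_{Ḃ^{s₁}_{p,r₁}} ‖u‖^θ_{Ḃ^{s₂}_{p,r₂}}`.
-/

noncomputable section

open MeasureTheory TemperedDistribution Set Function Filter Topology FourierTransform
open scoped SchwartzMap ENNReal NNReal Convolution LineDeriv

namespace Literature.Analysis.FluidPDE

/-! ## Kernels of the low-frequency cutoffs -/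

section Realisation

/-- The symbols are dilates of one another: `χ(2^{-j} ξ) = χ_0(2^{-j} ξ)` with `χ_0 = χ(2^0 ·)`.
[folklore] -/
theorem lowFreqSymbol_eq_zero_smul (j : ℤ) (ξ : EuclideanSpace ℝ (Fin 3)) :
    FunctionSpaces.lowFreqSymbol j ξ = FunctionSpaces.lowFreqSymbol 0 (((2 : ℝ) ^ (-j)) • ξ) := by
  simp [FunctionSpaces.lowFreqSymbol]

/-- Change of variables `x ↦ c x` (`c > 0`) in a Lebesgue integral over `ℝ³`:
`∫⁻ f(c x) dx = c⁻³ ∫⁻ f` (Mathlib `Measure.map_addHaar_smul`). [folklore] -/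
theorem lintegral_comp_smul_three (f : EuclideanSpace ℝ (Fin 3) → ℝ≥0∞) {c : ℝ} (hc : 0 < c) :
    ∫⁻ x, f (c • x) = ENNReal.ofReal ((c ^ 3)⁻¹) * ∫⁻ x, f x := by
  have hc0 : c ≠ 0 := hc.ne'
  let e : EuclideanSpace ℝ (Fin 3) ≃ᵐ EuclideanSpace ℝ (Fin 3) :=
    (Homeomorph.smul (isUnit_iff_ne_zero.2 hc0).unit).toMeasurableEquiv
  have he : (e : EuclideanSpace ℝ (Fin 3) → EuclideanSpace ℝ (Fin 3)) = fun x => c • x := rfl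
  calc ∫⁻ x, f (c • x) = ∫⁻ y, f y ∂(Measure.map (fun x => c • x) volume) := by
        rw [← he, lintegral_map_equiv]; rfl
    _ = ENNReal.ofReal ((c ^ 3)⁻¹) * ∫⁻ x, f x := by
        rw [Measure.map_addHaar_smul volume hc0, lintegral_smul_measure,
          finrank_euclideanSpace_fin, abs_of_nonneg (by positivity), smul_eq_mul]

/-- The `L²(ℝ³)` norm as the square root of `∫ ‖·‖²`. [folklore] -/
theorem eLpNorm_two_eq_lintegral_sq_rpow (F : EuclideanSpace ℝ (Fin 3) → ℂ) :
    eLpNorm F 2 (volume : Measure (EuclideanSpace ℝ (Fin 3))) =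
      (∫⁻ ξ, ‖F ξ‖ₑ ^ 2) ^ (1 / 2 : ℝ) := by
  rw [eLpNorm_eq_lintegral_rpow_enorm_toReal two_ne_zero ENNReal.ofNat_ne_top,
    ENNReal.toReal_ofNat]
  congr 1
  exact lintegral_congr fun ξ => ENNReal.rpow_two _

/-- **`L²` norm of the low-frequency kernels.** For Schwartz functions `Ψ`, `Ψ₀` representing the
symbols `χ(2^{-j}·)`, `χ(2^0 ·)`: `‖𝓕⁻¹ Ψ‖_{L²} = 2^{3j/2} ‖Ψ₀‖_{L²}` (Plancherel for the
Schwartz kernel, `Literature.Analysis.FunctionSpaces.eLpNorm_fourierIntegral_eq`, then the substitution `ξ = 2^{j} η`).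
[folklore] -/
theorem eLpNorm_fourierInv_of_coe_eq_lowFreqSymbol {j : ℤ} {Ψ Ψ₀ : 𝓢(EuclideanSpace ℝ (Fin 3), ℂ)}
    (hΨ : (Ψ : EuclideanSpace ℝ (Fin 3) → ℂ) = FunctionSpaces.lowFreqSymbol j)
    (hΨ₀ : (Ψ₀ : EuclideanSpace ℝ (Fin 3) → ℂ) = FunctionSpaces.lowFreqSymbol 0) :
    eLpNorm ((𝓕⁻ Ψ : 𝓢(EuclideanSpace ℝ (Fin 3), ℂ)) : EuclideanSpace ℝ (Fin 3) → ℂ) 2 volume =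
      ENNReal.ofReal ((((2 : ℝ) ^ j) ^ 3) ^ (1 / 2 : ℝ)) *
        eLpNorm (Ψ₀ : EuclideanSpace ℝ (Fin 3) → ℂ) 2 volume := by
  -- Plancherel: `‖𝓕⁻¹ Ψ‖₂ = ‖𝓕 𝓕⁻¹ Ψ‖₂ = ‖Ψ‖₂`
  set K : 𝓢(EuclideanSpace ℝ (Fin 3), ℂ) := 𝓕⁻ Ψ with hK
  have hP : eLpNorm (K : EuclideanSpace ℝ (Fin 3) → ℂ) 2 volume =
      eLpNorm (Ψ : EuclideanSpace ℝ (Fin 3) → ℂ) 2 volume := by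
    rw [← Literature.Analysis.FunctionSpaces.eLpNorm_fourierIntegral_eq K.integrable (K.memLp 2 volume),
      ← SchwartzMap.fourier_coe, hK, fourier_fourierInv_eq]
  rw [hP]
  -- scaling of the `L²` norm
  have hc : (0 : ℝ) < (2 : ℝ) ^ (-j) := zpow_pos (by norm_num) _
  have hscale : ∫⁻ ξ, ‖(Ψ : EuclideanSpace ℝ (Fin 3) → ℂ) ξ‖ₑ ^ 2 =
      ENNReal.ofReal (((2 : ℝ) ^ j) ^ 3) * ∫⁻ ξ, ‖(Ψ₀ : EuclideanSpace ℝ (Fin 3) → ℂ) ξ‖ₑ ^ 2 := by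
    have := lintegral_comp_smul_three (fun η => ‖(Ψ₀ : EuclideanSpace ℝ (Fin 3) → ℂ) η‖ₑ ^ 2) hc
    simp only [hΨ, hΨ₀] at this ⊢
    simp_rw [lowFreqSymbol_eq_zero_smul j]
    rw [this]
    congr 2
    rw [zpow_neg, inv_pow, inv_inv]
  rw [eLpNorm_two_eq_lintegral_sq_rpow, eLpNorm_two_eq_lintegral_sq_rpow, hscale,
    ENNReal.mul_rpow_of_nonneg _ _ (by norm_num : (0 : ℝ) ≤ 1 / 2),
    ENNReal.ofReal_rpow_of_nonneg (by positivity) (by norm_num)]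

/-! ## The discharge -/

/-- **Discharge of `tendsto_lowFreqCutoff_of_memLp_two`** (BCD Def. 1.26 with the Examples
p. 22: `L²` functions belong to `𝓢'_h`). For `f ∈ L²(ℝ³; ℝ³)` with distribution `W` — Mathlib's
tempered distribution of the `L²` class `g` of `complexify ∘ f`
(`isDistributionOf_toTemperedDistribution`, `IsDistributionOf.unique`) — the cutoff `Ṡ_j W`
is integration against the bounded function `(𝓕⁻¹χ(2^{-j}·)) ⋆ g`
(`Literature.Analysis.FunctionSpaces.fourierMultiplierCLM_coe_apply_eq_integral_convolution`), whose sup norm is at most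
`‖𝓕⁻¹χ(2^{-j}·)‖₂ ‖g‖₂ = 2^{3j/2} ‖χ_0‖₂ ‖g‖₂` (Cauchy–Schwarz in the convolution, Plancherel,
scaling); so `|⟨Ṡ_j W, u⟩| ≤ 2^{3j/2} ‖χ_0‖₂ ‖g‖₂ ‖u‖_{L¹} → 0` as `j → -∞` for every Schwartz
`u`, which is convergence to `0` in `𝓢'` (pointwise topology,
`PointwiseConvergenceCLM.tendsto_iff_forall_tendsto`).
[cite: BahouriCheminDanchin2011, Def. 1.26 and Examples p. 22] -/
theorem tendsto_lowFreqCutoff_of_memLp_two_holds : tendsto_lowFreqCutoff_of_memLp_two := by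
  intro f W hf hW
  -- `W` is Mathlib's tempered distribution of the `L²` class `g` of `complexify ∘ f`
  set g : Lp (EuclideanSpace ℂ (Fin 3)) 2 (volume : Measure (EuclideanSpace ℝ (Fin 3))) :=
    (memLp_complexify_comp hf).toLp _ with hg
  have hWg : W = (g : 𝓢'(EuclideanSpace ℝ (Fin 3), EuclideanSpace ℂ (Fin 3))) :=
    hW.unique (isDistributionOf_toTemperedDistribution hf)
  rw [PointwiseConvergenceCLM.tendsto_iff_forall_tendsto]
  intro u
  -- the symbols as Schwartz functions, the kernels `K_j = 𝓕⁻¹ Ψ_j`, and `h_j = K_j ⋆ g`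
  set Ψ : ℤ → 𝓢(EuclideanSpace ℝ (Fin 3), ℂ) := fun j =>
    (FunctionSpaces.hasCompactSupport_lowFreqSymbol j).toSchwartzMap (FunctionSpaces.contDiff_lowFreqSymbol j) with hΨdef
  have hΨ : ∀ j, ((Ψ j : 𝓢(EuclideanSpace ℝ (Fin 3), ℂ)) : EuclideanSpace ℝ (Fin 3) → ℂ) =
      FunctionSpaces.lowFreqSymbol j := fun j => rfl
  set K : ℤ → 𝓢(EuclideanSpace ℝ (Fin 3), ℂ) := fun j => 𝓕⁻ (Ψ j) with hKdef
  set h : ℤ → EuclideanSpace ℝ (Fin 3) → EuclideanSpace ℂ (Fin 3) := fun j =>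
    ((K j : 𝓢(EuclideanSpace ℝ (Fin 3), ℂ)) : EuclideanSpace ℝ (Fin 3) → ℂ)
      ⋆[ContinuousLinearMap.lsmul ℂ ℂ, volume]
        (g : EuclideanSpace ℝ (Fin 3) → EuclideanSpace ℂ (Fin 3))
    with hhdef
  -- the convolution representation of `Ṡ_j W`
  have hrep : ∀ j : ℤ, FunctionSpaces.lowFreqCutoff j W u = ∫ y, u y • h j y := fun j => by
    rw [hWg, FunctionSpaces.lowFreqCutoff_apply, ← hΨ j]
    exact FunctionSpaces.fourierMultiplierCLM_coe_apply_eq_integral_convolution (Ψ j) g u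
  -- the bound `‖h_j(y)‖ ≤ ‖K_j‖₂ ‖g‖₂ = 2^{3j/2} ‖Ψ_0‖₂ ‖g‖₂ =: M_j`
  set A : ℝ≥0∞ := eLpNorm ((Ψ 0 : 𝓢(EuclideanSpace ℝ (Fin 3), ℂ)) : EuclideanSpace ℝ (Fin 3) → ℂ)
    2 volume * eLpNorm g 2 volume with hA
  have hAtop : A ≠ ∞ :=
    ENNReal.mul_ne_top ((Ψ 0).memLp 2 volume).eLpNorm_ne_top (Lp.memLp g).eLpNorm_ne_top
  set M : ℤ → ℝ := fun j => ((((2 : ℝ) ^ j) ^ 3) ^ (1 / 2 : ℝ)) * A.toReal with hMdef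
  have hbound : ∀ (j : ℤ) (y : EuclideanSpace ℝ (Fin 3)), ‖h j y‖ ≤ M j := by
    intro j y
    have h1 : ‖h j y‖ₑ ≤
        eLpNorm ((K j : 𝓢(EuclideanSpace ℝ (Fin 3), ℂ)) : EuclideanSpace ℝ (Fin 3) → ℂ) 2 volume *
          eLpNorm (g : EuclideanSpace ℝ (Fin 3) → EuclideanSpace ℂ (Fin 3)) 2 volume :=
      FunctionSpaces.enorm_convolution_smul_le_eLpNorm_mul (K j).continuous.aestronglyMeasurable
        (Lp.aestronglyMeasurable g) 2 2 y
    rw [hKdef, eLpNorm_fourierInv_of_coe_eq_lowFreqSymbol (hΨ j) (hΨ 0), mul_assoc] at h1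
    have h2 : ‖h j y‖ₑ ≤ ENNReal.ofReal ((((2 : ℝ) ^ j) ^ 3) ^ (1 / 2 : ℝ)) * A := h1
    have htop : ENNReal.ofReal ((((2 : ℝ) ^ j) ^ 3) ^ (1 / 2 : ℝ)) * A ≠ ∞ :=
      ENNReal.mul_ne_top ENNReal.ofReal_ne_top hAtop
    calc ‖h j y‖ = (‖h j y‖ₑ).toReal := (toReal_enorm _).symm
      _ ≤ (ENNReal.ofReal ((((2 : ℝ) ^ j) ^ 3) ^ (1 / 2 : ℝ)) * A).toReal :=
          ENNReal.toReal_mono htop h2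
      _ = M j := by
          rw [hMdef, ENNReal.toReal_mul, ENNReal.toReal_ofReal (by positivity)]
  -- `|⟨Ṡ_j W, u⟩| ≤ M_j ‖u‖_{L¹}`
  have hest : ∀ j : ℤ, ‖FunctionSpaces.lowFreqCutoff j W u‖ ≤ M j * ∫ y, ‖u y‖ := by
    intro j
    rw [hrep j]
    calc ‖∫ y, u y • h j y‖ ≤ ∫ y, ‖u y • h j y‖ := norm_integral_le_integral_norm _
      _ ≤ ∫ y, ‖u y‖ * M j := by
          refine integral_mono_of_nonneg (Eventually.of_forall fun y => norm_nonneg _)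
            (u.integrable.norm.mul_const _) (Eventually.of_forall fun y => ?_)
          show ‖u y • h j y‖ ≤ ‖u y‖ * M j
          rw [norm_smul]
          exact mul_le_mul_of_nonneg_left (hbound j y) (norm_nonneg _)
      _ = M j * ∫ y, ‖u y‖ := by rw [integral_mul_const, mul_comm]
  -- `M_j → 0` as `j → -∞`
  have hM : Tendsto M atBot (𝓝 0) := by
    have h1 : Tendsto (fun j : ℤ => ((2 : ℝ) ^ j) ^ 3) atBot (𝓝 0) := by
      simpa using Literature.Analysis.FunctionSpaces.tendsto_two_zpow_atBot.pow 3
    have h2 : Tendsto (fun j : ℤ => (((2 : ℝ) ^ j) ^ 3) ^ (1 / 2 : ℝ)) atBot (𝓝 0) := by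
      have := ((Real.continuous_rpow_const (by norm_num : (0 : ℝ) ≤ 1 / 2)).tendsto 0).comp h1
      simpa [Function.comp_def, Real.zero_rpow (by norm_num : (1 / 2 : ℝ) ≠ 0)] using this
    simpa [hMdef] using h2.mul_const A.toReal
  have hlim : Tendsto (fun j => M j * ∫ y, ‖u y‖) atBot (𝓝 0) := by
    simpa using hM.mul_const (∫ y, ‖u y‖)
  simpa using squeeze_zero_norm hest hlim

end Realisation

end Literature.Analysis.FluidPDE

namespace Literature.Analysis.FluidPDE

/-! ## Uniform `L^p` bounds and the reverse Bernstein inequality on the dyadic blocks -/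

section BlockBounds

variable {E : Type*} [NormedAddCommGroup E] [InnerProductSpace ℝ E] [FiniteDimensional ℝ E]
  [MeasurableSpace E] [BorelSpace E] {F : Type*} [NormedAddCommGroup F] [NormedSpace ℂ F]
  [CompleteSpace F]

/-- **The dyadic blocks are uniformly bounded on `L^p`** (Danchin 2018, §2.1, p. 4: "operators
`Δ̇_j` and `Ṡ_j` are continuous on `L^p`, with norm independent of `j`"; BCD §2.2):
`‖Δ̇_j u‖_{L^p} ≤ C ‖u‖_{L^p}` for all `j ∈ ℤ`, `u ∈ 𝓢'(E, F)` (`= ∞` off `L^p`), from the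
low-frequency bound `‖Ṡ_k u‖_{L^p} ≤ C ‖u‖_{L^p}` (`Literature.Analysis.FluidPDE.exists_eLpNormDistrib_lowFreqCutoff_le`
with `r = p`) and `Δ̇_j = Ṡ_j - Ṡ_{j-1}`. [cite: Danchin2018FourierCNS, §2.1 p. 4] -/
theorem exists_eLpNormDistrib_lpBlock_le_eLpNormDistrib (p : ℝ≥0∞) [Fact (1 ≤ p)] :
    ∃ C : ℝ≥0, ∀ (j : ℤ) (u : 𝓢'(E, F)),
      FunctionSpaces.eLpNormDistrib p (FunctionSpaces.lpBlock j u) ≤ C * FunctionSpaces.eLpNormDistrib p u := by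
  obtain ⟨C, -, hC⟩ := exists_eLpNormDistrib_lowFreqCutoff_le (E := E) (F := F) p p le_rfl
  refine ⟨C + C, fun j u => ?_⟩
  have hk : ∀ k : ℤ, FunctionSpaces.eLpNormDistrib p (FunctionSpaces.lowFreqCutoff k u) ≤ C * FunctionSpaces.eLpNormDistrib p u := fun k => by
    simpa only [sub_self, mul_zero, ENNReal.rpow_zero, mul_one] using hC k u
  have hsub : FunctionSpaces.lpBlock j u = FunctionSpaces.lowFreqCutoff j u + -FunctionSpaces.lowFreqCutoff (j - 1) u := by
    rw [FunctionSpaces.lpBlock_eq_sub_holds j, sub_apply, sub_eq_add_neg]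
  calc FunctionSpaces.eLpNormDistrib p (FunctionSpaces.lpBlock j u)
      ≤ FunctionSpaces.eLpNormDistrib p (FunctionSpaces.lowFreqCutoff j u) + FunctionSpaces.eLpNormDistrib p (-FunctionSpaces.lowFreqCutoff (j - 1) u) := by
        rw [hsub]; exact eLpNormDistrib_add_le _ _
    _ ≤ C * FunctionSpaces.eLpNormDistrib p u + C * FunctionSpaces.eLpNormDistrib p u := by
        rw [eLpNormDistrib_neg]; exact add_le_add (hk j) (hk (j - 1))
    _ = ((C + C : ℝ≥0) : ℝ≥0∞) * FunctionSpaces.eLpNormDistrib p u := by push_cast; ring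

open scoped ContDiff in
omit [FiniteDimensional ℝ E] [MeasurableSpace E] [BorelSpace E] in
/-- The symbol `ξ ↦ ⟪ξ, m⟫ / ‖ξ‖²` (of `∂_m (-Δ)⁻¹` up to `2π i`) is smooth off the origin.
[folklore] -/
theorem contDiffOn_inner_div_norm_sq (m : E) :
    ContDiffOn ℝ ∞ (fun ξ : E => ((inner ℝ ξ m / ‖ξ‖ ^ 2 : ℝ) : ℂ)) {0}ᶜ := by
  refine Complex.ofRealCLM.contDiff.comp_contDiffOn (ContDiffOn.div ?_ ?_ fun ξ hξ => ?_)
  · exact (contDiff_id.inner ℝ contDiff_const).contDiffOn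
  · exact (contDiff_norm_sq ℝ).contDiffOn
  · exact pow_ne_zero 2 (norm_ne_zero_iff.2 hξ)

omit [FiniteDimensional ℝ E] [MeasurableSpace E] [BorelSpace E] in
/-- The symbol `ξ ↦ ⟪ξ, m⟫ / ‖ξ‖²` is positively homogeneous of degree `-1`. [folklore] -/
theorem inner_div_norm_sq_smul (m : E) (c : ℝ) (hc : 0 < c) (ξ : E) (_hξ : ξ ≠ 0) :
    (fun ξ : E => ((inner ℝ ξ m / ‖ξ‖ ^ 2 : ℝ) : ℂ)) (c • ξ) =
      ((c ^ (-1 : ℝ) : ℝ) : ℂ) * (fun ξ : E => ((inner ℝ ξ m / ‖ξ‖ ^ 2 : ℝ) : ℂ)) ξ := by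
  simp only [real_inner_smul_left, norm_smul, Real.norm_of_nonneg hc.le, Real.rpow_neg_one]
  push_cast
  by_cases hξ : ‖ξ‖ = 0
  · simp [hξ]
  · have hc0 : (c : ℂ) ≠ 0 := by exact_mod_cast hc.ne'
    have hn : ((‖ξ‖ : ℝ) : ℂ) ≠ 0 := by exact_mod_cast hξ
    field_simp

/-- **Reverse Bernstein inequality on the dyadic blocks** (Danchin 2018, Prop. 2.1, second
inequality, `k = 1`: for `supp û ⊂ {rλ ≤ |ξ| ≤ Rλ}`, `λ ‖u‖_{L^p} ≤ C² ‖Du‖_{L^p}`; = BCD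
Lemma 2.1; here `λ = 2^j` and the spectral localisation is `Δ̇_j`): for `1 ≤ p ≤ ∞` and an
orthonormal basis `b` there is `C` with `‖Δ̇_j u‖_{L^p} ≤ C 2^{-j} ∑_i ‖Δ̇_j ∂_{b_i} u‖_{L^p}`
for all `j ∈ ℤ`, `u ∈ 𝓢'(E, F)`. Proof as in BCD: `Δ̇_j u = ∑_i σ_{i,j}(D) ⟪D, b_i⟫ Δ̇_j u` with
the block-truncated symbols `σ_{i,j} = (⟪ξ, b_i⟫/‖ξ‖²) ψ(2^{-j} ξ)` of degree `-1`
(`∑_i ⟪ξ, b_i⟫²/‖ξ‖² = 1`, `ψ(2^{-j}·) = 1` on `supp φ_j`), the homogeneous-multiplier lemma on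
the blocks (`Literature.Analysis.FunctionSpaces.exists_eLpNormDistrib_truncSymbol_lpBlock_le_of_homogeneous`, BCD Lemma 2.2), and
`⟪D, b_i⟫ = (2π i)⁻¹ ∂_{b_i}` (Mathlib's `TemperedDistribution.lineDeriv_eq_fourierMultiplierCLM`)
commuting with `Δ̇_j`. [cite: Danchin2018FourierCNS, Prop. 2.1] -/
theorem exists_eLpNormDistrib_lpBlock_le_sum_lineDeriv (p : ℝ≥0∞) [Fact (1 ≤ p)] {ι : Type*}
    [Fintype ι] (b : OrthonormalBasis ι ℝ E) :
    ∃ C : ℝ≥0, ∀ (j : ℤ) (u : 𝓢'(E, F)),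
      FunctionSpaces.eLpNormDistrib p (FunctionSpaces.lpBlock j u) ≤
        C * (2 : ℝ≥0∞) ^ (-(j : ℝ)) * ∑ i, FunctionSpaces.eLpNormDistrib p (FunctionSpaces.lpBlock j (∂_{b i} u)) := by
  classical
  -- BCD Lemma 2.2 for the degree `-1` symbols `⟪ξ, b i⟫ / ‖ξ‖²`
  choose C hC using fun i : ι =>
    FunctionSpaces.exists_eLpNormDistrib_truncSymbol_lpBlock_le_of_homogeneous (E := E) (F := F) p
      (contDiffOn_inner_div_norm_sq (b i)) (inner_div_norm_sq_smul (b i))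
  set c : ℂ := 2 * Real.pi * Complex.I with hcdef
  have hc : c ≠ 0 := by simp [hcdef, Real.pi_ne_zero]
  refine ⟨‖c⁻¹‖₊ * ∑ i, C i, fun j u => ?_⟩
  -- the symbols
  set τ : ι → E → ℂ := fun i => FunctionSpaces.truncSymbol (fun ξ : E => ((inner ℝ ξ (b i) / ‖ξ‖ ^ 2 : ℝ) : ℂ)) j
    with hτdef
  have hτ : ∀ i, (τ i).HasTemperateGrowth := fun i =>
    FunctionSpaces.hasTemperateGrowth_truncSymbol (contDiffOn_inner_div_norm_sq (b i)) j
  have hinn : ∀ i, (fun x : E => ((inner ℝ x (b i) : ℝ) : ℂ)).HasTemperateGrowth := fun i => by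
    fun_prop
  -- `ψ(2^{-j} ξ) = ∑_i ⟪ξ, b i⟫ σ_{i,j}(ξ)`
  have hsum : (fun ξ : E => FunctionSpaces.bernsteinSymbol (((2 : ℝ) ^ (-j)) • ξ)) =
      fun ξ => ∑ i ∈ Finset.univ, ((fun x : E => ((inner ℝ x (b i) : ℝ) : ℂ)) * τ i) ξ := by
    funext ξ
    simp only [Pi.mul_apply, hτdef, FunctionSpaces.truncSymbol_apply]
    by_cases hξ : ξ = 0
    · subst hξ
      simp [FunctionSpaces.bernsteinSymbol_eq_zero_of_norm_le]
    · have hn : (‖ξ‖ ^ 2 : ℝ) ≠ 0 := pow_ne_zero 2 (norm_ne_zero_iff.2 hξ)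
      have key : ∑ i, ((inner ℝ ξ (b i) : ℝ) : ℂ) * ((inner ℝ ξ (b i) / ‖ξ‖ ^ 2 : ℝ) : ℂ) = 1 := by
        have h1 : ∑ i, (inner ℝ ξ (b i)) * (inner ℝ ξ (b i) / ‖ξ‖ ^ 2) = (1 : ℝ) := by
          have h3 : ∀ i, (inner ℝ ξ (b i)) * (inner ℝ ξ (b i) / ‖ξ‖ ^ 2) =
              (inner ℝ ξ (b i)) ^ 2 / ‖ξ‖ ^ 2 := fun i => by ring
          simp_rw [h3]
          rw [← Finset.sum_div, b.sum_sq_inner_left ξ, div_self hn]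
        exact_mod_cast congrArg (fun r : ℝ => (r : ℂ)) h1
      symm
      calc ∑ i, ((inner ℝ ξ (b i) : ℝ) : ℂ) *
            (((inner ℝ ξ (b i) / ‖ξ‖ ^ 2 : ℝ) : ℂ) * FunctionSpaces.bernsteinSymbol (((2 : ℝ) ^ (-j)) • ξ))
          = (∑ i, ((inner ℝ ξ (b i) : ℝ) : ℂ) * ((inner ℝ ξ (b i) / ‖ξ‖ ^ 2 : ℝ) : ℂ)) *
              FunctionSpaces.bernsteinSymbol (((2 : ℝ) ^ (-j)) • ξ) := by
            rw [Finset.sum_mul]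
            refine Finset.sum_congr rfl fun i _ => ?_
            ring
        _ = FunctionSpaces.bernsteinSymbol (((2 : ℝ) ^ (-j)) • ξ) := by rw [key, one_mul]
  -- `Δ̇_j u = ∑_i (2πi)⁻¹ σ_{i,j}(D) Δ̇_j ∂_{b i} u`
  have hId : FunctionSpaces.lpBlock j u =
      ∑ i, c⁻¹ • fourierMultiplierCLM F (τ i) (FunctionSpaces.lpBlock j (∂_{b i} u)) := by
    conv_lhs => rw [FunctionSpaces.lpBlock_eq_fourierMultiplierCLM_bernsteinSymbol_rescaled j u, hsum,
      fourierMultiplierCLM_sum F (fun i _ => (hinn i).mul (hτ i))]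
    rw [FunLike.coe_sum, Finset.sum_apply]
    refine Finset.sum_congr rfl fun i _ => ?_
    rw [← fourierMultiplierCLM_fourierMultiplierCLM_apply (hinn i) (hτ i)]
    have h := TemperedDistribution.lineDeriv_eq_fourierMultiplierCLM (b i) (FunctionSpaces.lpBlock j u)
    have h' : fourierMultiplierCLM F (fun x : E => ((inner ℝ x (b i) : ℝ) : ℂ)) (FunctionSpaces.lpBlock j u) =
        c⁻¹ • ∂_{b i} (FunctionSpaces.lpBlock j u) := by
      rw [h, smul_smul, inv_mul_cancel₀ hc, one_smul]
    rw [h', map_smul, ← FunctionSpaces.lpBlock_lineDeriv_comm]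
  -- norms
  have h2 : (2 : ℝ≥0∞) ^ ((j : ℝ) * (-1)) = (2 : ℝ≥0∞) ^ (-(j : ℝ)) := by rw [mul_neg_one]
  calc FunctionSpaces.eLpNormDistrib p (FunctionSpaces.lpBlock j u)
      = FunctionSpaces.eLpNormDistrib p (∑ i, c⁻¹ • fourierMultiplierCLM F (τ i) (FunctionSpaces.lpBlock j (∂_{b i} u))) := by
        rw [← hId]
    _ ≤ ∑ i, FunctionSpaces.eLpNormDistrib p (c⁻¹ • fourierMultiplierCLM F (τ i) (FunctionSpaces.lpBlock j (∂_{b i} u))) :=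
        eLpNormDistrib_sum_le p _ _
    _ = ∑ i, ‖c⁻¹‖ₑ * FunctionSpaces.eLpNormDistrib p (fourierMultiplierCLM F (τ i) (FunctionSpaces.lpBlock j (∂_{b i} u))) := by
        refine Finset.sum_congr rfl fun i _ => ?_
        rw [FunctionSpaces.eLpNormDistrib_const_smul (inv_ne_zero hc)]
    _ ≤ ∑ i, ‖c⁻¹‖ₑ * ((∑ k, C k : ℝ≥0) * (2 : ℝ≥0∞) ^ (-(j : ℝ)) *
          FunctionSpaces.eLpNormDistrib p (FunctionSpaces.lpBlock j (∂_{b i} u))) := by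
        gcongr with i hi
        refine (hC i j _).trans ?_
        rw [h2]
        gcongr
        exact_mod_cast Finset.single_le_sum (fun k _ => zero_le) hi
    _ = ((‖c⁻¹‖₊ * ∑ i, C i : ℝ≥0) : ℝ≥0∞) * (2 : ℝ≥0∞) ^ (-(j : ℝ)) *
          ∑ i, FunctionSpaces.eLpNormDistrib p (FunctionSpaces.lpBlock j (∂_{b i} u)) := by
        rw [Finset.mul_sum, ENNReal.coe_mul, ← enorm_eq_nnnorm]
        refine Finset.sum_congr rfl fun i _ => ?_
        ring

end BlockBounds

section DyadicInterpolation

/-- **Real interpolation at the level of dyadic sums** (the computation behind the Besov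
interpolation inequality `‖u‖_{Ḃ^{θs₂+(1-θ)s₁}_{p,r}} ≲ ‖u‖^{1-θ}_{Ḃ^{s₁}_{p,∞}} ‖u‖^θ_{Ḃ^{s₂}_{p,∞}}`,
Danchin 2018, §2.1, p. 4, "Interpolation", here `θ = 1/2`, `r = 1`, `s₁ = 0`, `s₂ = 1`): there is
an absolute constant `K` such that every sequence `w : ℤ → [0, ∞]` with `w_j ≤ 2^{j/2} A` and
`w_j ≤ 2^{-j/2} B` for all `j` satisfies `∑_j w_j ≤ K √A √B` — split the sum at `2^{j₀} ≈ B/A`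
and sum two geometric series. [cite: Danchin2018FourierCNS, §2.1 p. 4] -/
theorem exists_tsum_le_sqrt_mul_sqrt :
    ∃ K : ℝ≥0, ∀ (w : ℤ → ℝ≥0∞) (A B : ℝ≥0∞),
      (∀ j, w j ≤ (2 : ℝ≥0∞) ^ ((j : ℝ) / 2) * A) →
      (∀ j, w j ≤ (2 : ℝ≥0∞) ^ (-((j : ℝ) / 2)) * B) →
        ∑' j, w j ≤ K * A ^ (1 / 2 : ℝ) * B ^ (1 / 2 : ℝ) := by
  -- the ratio `ρ = 2^{-1/2}` of the two geometric series and the constant `K = 2 (1 - ρ)⁻¹`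
  set ρ : ℝ≥0∞ := (2 : ℝ≥0∞) ^ (-(1 / 2 : ℝ)) with hρ
  have hρ1 : ρ < 1 := ENNReal.rpow_lt_one_of_one_lt_of_neg (by norm_num) (by norm_num)
  have hS : (1 - ρ)⁻¹ ≠ ⊤ := ENNReal.inv_ne_top.2 (tsub_pos_of_lt hρ1).ne'
  have hKtop : 2 * (1 - ρ)⁻¹ ≠ ⊤ := ENNReal.mul_ne_top ENNReal.ofNat_ne_top hS
  refine ⟨(2 * (1 - ρ)⁻¹).toNNReal, fun w A B hwA hwB => ?_⟩
  rw [ENNReal.coe_toNNReal hKtop]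
  have hK0 : (2 * (1 - ρ)⁻¹ : ℝ≥0∞) ≠ 0 :=
    mul_ne_zero two_ne_zero (ENNReal.inv_ne_zero.2 (ENNReal.sub_ne_top ENNReal.one_ne_top))
  have h2 : (2 : ℝ≥0∞) ≠ 0 := two_ne_zero
  have h2' : (2 : ℝ≥0∞) ≠ ⊤ := ENNReal.ofNat_ne_top
  -- degenerate cases
  rcases eq_or_ne A 0 with rfl | hA0
  · have : ∀ j, w j = 0 := fun j => le_zero_iff.1 (by simpa using hwA j)
    simp [this]
  rcases eq_or_ne B 0 with rfl | hB0
  · have : ∀ j, w j = 0 := fun j => le_zero_iff.1 (by simpa using hwB j)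
    simp [this]
  have hA2 : A ^ (1 / 2 : ℝ) ≠ 0 := fun h => by
    rcases ENNReal.rpow_eq_zero_iff.1 h with ⟨h, -⟩ | ⟨-, h⟩
    · exact hA0 h
    · norm_num at h
  have hB2 : B ^ (1 / 2 : ℝ) ≠ 0 := fun h => by
    rcases ENNReal.rpow_eq_zero_iff.1 h with ⟨h, -⟩ | ⟨-, h⟩
    · exact hB0 h
    · norm_num at h
  rcases eq_or_ne A ⊤ with rfl | hAtop
  · rw [ENNReal.top_rpow_of_pos (by norm_num), ENNReal.mul_top hK0, ENNReal.top_mul hB2]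
    exact le_top
  rcases eq_or_ne B ⊤ with rfl | hBtop
  · rw [ENNReal.top_rpow_of_pos (by norm_num), ENNReal.mul_top (mul_ne_zero hK0 hA2)]
    exact le_top
  -- main case: bracket `B/A` between consecutive powers of `2`
  have ha : 0 < A.toReal := ENNReal.toReal_pos hA0 hAtop
  have hb : 0 < B.toReal := ENNReal.toReal_pos hB0 hBtop
  obtain ⟨j₀, hj₀⟩ := exists_mem_Ico_zpow (div_pos hb ha) one_lt_two
  have hle : (2 : ℝ≥0∞) ^ ((j₀ : ℝ)) * A ≤ B := by
    have h : (2 : ℝ) ^ j₀ * A.toReal ≤ B.toReal := (le_div_iff₀ ha).1 hj₀.1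
    rw [← FunctionSpaces.ofReal_two_zpow, ← ENNReal.ofReal_toReal hAtop, ← ENNReal.ofReal_toReal hBtop,
      ← ENNReal.ofReal_mul (zpow_nonneg zero_le_two _)]
    exact ENNReal.ofReal_le_ofReal h
  have hge : B ≤ (2 : ℝ≥0∞) ^ (((j₀ + 1 : ℤ) : ℝ)) * A := by
    have h : B.toReal ≤ (2 : ℝ) ^ (j₀ + 1) * A.toReal := ((div_lt_iff₀ ha).1 hj₀.2).le
    rw [← FunctionSpaces.ofReal_two_zpow, ← ENNReal.ofReal_toReal hAtop, ← ENNReal.ofReal_toReal hBtop,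
      ← ENNReal.ofReal_mul (zpow_nonneg zero_le_two _)]
    exact ENNReal.ofReal_le_ofReal h
  -- hence `2^{j₀/2} A ≤ √A √B` and `2^{-(j₀+1)/2} B ≤ √A √B`
  have hsq : ∀ x : ℝ≥0∞, (x * x) ^ (1 / 2 : ℝ) = x := fun x => by
    rw [← sq, ← ENNReal.rpow_two, ← ENNReal.rpow_mul]; norm_num
  have k1 : (2 : ℝ≥0∞) ^ ((j₀ : ℝ) / 2) * A ≤ A ^ (1 / 2 : ℝ) * B ^ (1 / 2 : ℝ) := by
    have e : (2 : ℝ≥0∞) ^ ((j₀ : ℝ) / 2) * A =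
        ((2 : ℝ≥0∞) ^ ((j₀ : ℝ)) * A * A) ^ (1 / 2 : ℝ) := by
      rw [mul_assoc, ENNReal.mul_rpow_of_nonneg _ _ (by norm_num : (0 : ℝ) ≤ 1 / 2), hsq,
        ← ENNReal.rpow_mul, mul_one_div]
    rw [e, ← ENNReal.mul_rpow_of_nonneg _ _ (by norm_num : (0 : ℝ) ≤ 1 / 2), mul_comm A B]
    gcongr
  have k2 : (2 : ℝ≥0∞) ^ (-(((j₀ + 1 : ℤ) : ℝ) / 2)) * B ≤ A ^ (1 / 2 : ℝ) * B ^ (1 / 2 : ℝ) := by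
    have hcB : (2 : ℝ≥0∞) ^ (-(((j₀ + 1 : ℤ) : ℝ))) * B ≤ A := by
      calc (2 : ℝ≥0∞) ^ (-(((j₀ + 1 : ℤ) : ℝ))) * B
          ≤ (2 : ℝ≥0∞) ^ (-(((j₀ + 1 : ℤ) : ℝ))) * ((2 : ℝ≥0∞) ^ (((j₀ + 1 : ℤ) : ℝ)) * A) := by
            gcongr
        _ = A := by
            rw [← mul_assoc, FunctionSpaces.two_rpow_mul_two_rpow, neg_add_cancel, ENNReal.rpow_zero, one_mul]
    have e : (2 : ℝ≥0∞) ^ (-(((j₀ + 1 : ℤ) : ℝ) / 2)) * B =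
        ((2 : ℝ≥0∞) ^ (-(((j₀ + 1 : ℤ) : ℝ))) * B * B) ^ (1 / 2 : ℝ) := by
      rw [mul_assoc, ENNReal.mul_rpow_of_nonneg _ _ (by norm_num : (0 : ℝ) ≤ 1 / 2), hsq,
        ← ENNReal.rpow_mul, neg_mul, mul_one_div]
    rw [e, ← ENNReal.mul_rpow_of_nonneg _ _ (by norm_num : (0 : ℝ) ≤ 1 / 2)]
    gcongr
  -- shift the summation index by `j₀ + 1` and split into `ℕ` and `-(ℕ + 1)`
  rw [← (Equiv.addRight (j₀ + 1)).tsum_eq w]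
  simp only [Equiv.coe_addRight]
  rw [tsum_of_nat_of_neg_add_one ENNReal.summable ENNReal.summable]
  -- the two geometric tails
  have hpos : ∀ n : ℕ, w ((n : ℤ) + (j₀ + 1)) ≤
      (2 : ℝ≥0∞) ^ (-(((j₀ + 1 : ℤ) : ℝ) / 2)) * B * ρ ^ n := by
    intro n
    refine (hwB _).trans (le_of_eq ?_)
    rw [hρ, ← ENNReal.rpow_natCast, ← ENNReal.rpow_mul, mul_right_comm, FunctionSpaces.two_rpow_mul_two_rpow]
    congr 2
    push_cast
    ring
  have hneg : ∀ n : ℕ, w (-((n : ℤ) + 1) + (j₀ + 1)) ≤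
      (2 : ℝ≥0∞) ^ ((j₀ : ℝ) / 2) * A * ρ ^ n := by
    intro n
    refine (hwA _).trans (le_of_eq ?_)
    rw [hρ, ← ENNReal.rpow_natCast, ← ENNReal.rpow_mul, mul_right_comm, FunctionSpaces.two_rpow_mul_two_rpow]
    congr 2
    push_cast
    ring
  calc ∑' n : ℕ, w ((n : ℤ) + (j₀ + 1)) + ∑' n : ℕ, w (-((n : ℤ) + 1) + (j₀ + 1))
      ≤ ∑' n : ℕ, (2 : ℝ≥0∞) ^ (-(((j₀ + 1 : ℤ) : ℝ) / 2)) * B * ρ ^ n +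
          ∑' n : ℕ, (2 : ℝ≥0∞) ^ ((j₀ : ℝ) / 2) * A * ρ ^ n :=
        add_le_add (ENNReal.tsum_le_tsum hpos) (ENNReal.tsum_le_tsum hneg)
    _ = (2 : ℝ≥0∞) ^ (-(((j₀ + 1 : ℤ) : ℝ) / 2)) * B * (1 - ρ)⁻¹ +
          (2 : ℝ≥0∞) ^ ((j₀ : ℝ) / 2) * A * (1 - ρ)⁻¹ := by
        rw [ENNReal.tsum_mul_left, ENNReal.tsum_geometric, ENNReal.tsum_mul_left,
          ENNReal.tsum_geometric]
    _ ≤ A ^ (1 / 2 : ℝ) * B ^ (1 / 2 : ℝ) * (1 - ρ)⁻¹ +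
          A ^ (1 / 2 : ℝ) * B ^ (1 / 2 : ℝ) * (1 - ρ)⁻¹ := by
        gcongr
    _ = 2 * (1 - ρ)⁻¹ * A ^ (1 / 2 : ℝ) * B ^ (1 / 2 : ℝ) := by ring

end DyadicInterpolation

end Literature.Analysis.FluidPDE

namespace Literature.Analysis.FluidPDE

section DerivativeDistribution

variable {ι : Type*} [Fintype ι] {E : Type*} [NormedAddCommGroup E] [InnerProductSpace ℝ E]
  [FiniteDimensional ℝ E] [MeasureSpace E] [BorelSpace E]
  [(volume : Measure E).IsAddHaarMeasure]

/-- **The distributional derivative of a `C¹ ∩ L²` field with `L²` derivative is its classical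
derivative** (integration by parts against Schwartz functions, no boundary terms since
`φ f, φ ∂f, (∂φ) f ∈ L¹` by Cauchy–Schwarz; Mathlib's
`integral_bilinear_hasFDerivAt_right_eq_neg_left_of_integrable`): if `W` is the distribution of
`f` then `∂_m W` is the distribution of `x ↦ Df(x) m`. [folklore] -/
theorem IsDistributionOf.lineDeriv {f : E → EuclideanSpace ℝ ι} {W : 𝓢'(E, EuclideanSpace ℂ ι)}
    (hW : IsDistributionOf f W) (hf : ContDiff ℝ 1 f) (hf2 : MemLp f 2 volume) (m : E)
    (hfm : MemLp (fun x => fderiv ℝ f x m) 2 volume) :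
    IsDistributionOf (fun x => fderiv ℝ f x m) (∂_{m} W) := by
  intro φ
  -- the complexified field and its derivative
  set cf : E → EuclideanSpace ℂ ι := fun x => FunctionSpaces.EuclideanSpace.complexify (f x) with hcfdef
  set cf' : E → E →L[ℝ] EuclideanSpace ℂ ι := fun x =>
    (FunctionSpaces.EuclideanSpace.complexify (ι := ι)).toContinuousLinearMap.comp (fderiv ℝ f x) with hcf'def
  have hcf : ∀ x, HasFDerivAt cf (cf' x) x := fun x =>
    (FunctionSpaces.EuclideanSpace.complexify (ι := ι)).toContinuousLinearMap.hasFDerivAt.comp x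
      ((hf.differentiable one_ne_zero) x).hasFDerivAt
  have hcf'm : ∀ x, cf' x m = FunctionSpaces.EuclideanSpace.complexify (fderiv ℝ f x m) := fun x => rfl
  -- square integrability
  have hcf2 : MemLp cf 2 volume := memLp_complexify_comp hf2
  have hcfm2 : MemLp (fun x => cf' x m) 2 volume := memLp_complexify_comp hfm
  have hφ2 : MemLp (φ : E → ℂ) 2 volume := φ.memLp 2 volume
  have hdφ2 : MemLp (fun x => fderiv ℝ (φ : E → ℂ) x m) 2 volume :=
    (∂_{m} φ : 𝓢(E, ℂ)).memLp 2 volume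
  have i1 : Integrable (fun x => φ x • cf' x m) := memLp_one_iff_integrable.1 (hcfm2.smul hφ2)
  have i2 : Integrable (fun x => (fderiv ℝ (φ : E → ℂ) x m) • cf x) :=
    memLp_one_iff_integrable.1 (hcf2.smul hdφ2)
  have i3 : Integrable (fun x => φ x • cf x) := memLp_one_iff_integrable.1 (hcf2.smul hφ2)
  -- integration by parts
  have hIBP : ∫ x, φ x • cf' x m = -∫ x, (fderiv ℝ (φ : E → ℂ) x m) • cf x := by
    have := integral_bilinear_hasFDerivAt_right_eq_neg_left_of_integrable (μ := volume)
      (B := ContinuousLinearMap.lsmul ℝ ℂ) (f := (φ : E → ℂ)) (f' := fderiv ℝ (φ : E → ℂ))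
      (g := cf) (g' := cf') (v := m) (by simpa using i2) (by simpa using i1) (by simpa using i3)
      (fun x _ => φ.differentiableAt.hasFDerivAt) (fun x _ => hcf x)
    simpa using this
  refine ⟨by simpa only [hcf'm] using i1, ?_⟩
  rw [TemperedDistribution.lineDerivOp_apply_apply, (hW (-∂_{m} φ)).2]
  simp only [neg_apply, SchwartzMap.lineDerivOp_apply_eq_fderiv, neg_smul, integral_neg]
  rw [← hIBP]
  rfl

end DerivativeDistribution


section SobolevBesov

/-- **`H¹(ℝ³) ⊂ Ḃ^{1/2}_{2,1}(ℝ³)`, multiplicatively** (the interpolation inequality of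
Danchin 2018, §2.1, p. 4 with `θ = 1/2`, `r = 1`: `‖u‖_{Ḃ^{1/2}_{2,1}} ≲ ‖u‖^{1/2}_{Ḃ^0_{2,∞}}
‖u‖^{1/2}_{Ḃ^1_{2,∞}}`, combined with `‖u‖_{Ḃ^0_{2,∞}} ≲ ‖u‖_{L²}` and
`‖u‖_{Ḃ^1_{2,∞}} ≲ ‖∇u‖_{L²}`; BCD Prop. 1.32 is the `Ḣ^s` form): there is `K` such that for every
`C¹` field `f ∈ L²(ℝ³; ℝ³)` with tempered distribution `W`,
`‖W‖_{Ḃ^{1/2}_{2,1}} ≤ K ‖f‖_{L²}^{1/2} ‖Df‖_{L²}^{1/2}`: the weights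
`2^{j/2} ‖Δ̇_j W‖_{L²}` are bounded both by `C 2^{j/2} ‖f‖_{L²}`
(`exists_eLpNormDistrib_lpBlock_le_eLpNormDistrib`) and by `C 2^{-j/2} ‖Df‖_{L²}` (reverse
Bernstein `exists_eLpNormDistrib_lpBlock_le_sum_lineDeriv`, the distributional derivatives of `W`
being the classical ones, `IsDistributionOf.lineDeriv`), and `∑_j min(2^{j/2} A, 2^{-j/2} B) ≤
K √(AB)` (`exists_tsum_le_sqrt_mul_sqrt`). If `Df ∉ L²` the right-hand side is `∞` (or `f = 0`).
[cite: Danchin2018FourierCNS, §2.1 p. 4 and Prop. 2.1] -/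
theorem exists_eHomBesovNorm_half_le_sqrt_mul_sqrt :
    ∃ K : ℝ≥0, ∀ ⦃f : EuclideanSpace ℝ (Fin 3) → EuclideanSpace ℝ (Fin 3)⦄
      ⦃W : 𝓢'(EuclideanSpace ℝ (Fin 3), EuclideanSpace ℂ (Fin 3))⦄,
      ContDiff ℝ 1 f → MemLp f 2 volume → IsDistributionOf f W →
        FunctionSpaces.eHomBesovNorm (1 / 2) 2 1 W ≤
          K * eLpNorm f 2 volume ^ (1 / 2 : ℝ) * eLpNorm (fderiv ℝ f) 2 volume ^ (1 / 2 : ℝ) := by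
  obtain ⟨CA, hCA⟩ := exists_eLpNormDistrib_lpBlock_le_eLpNormDistrib
    (E := EuclideanSpace ℝ (Fin 3)) (F := EuclideanSpace ℂ (Fin 3)) 2
  obtain ⟨CB, hCB⟩ := exists_eLpNormDistrib_lpBlock_le_sum_lineDeriv
    (E := EuclideanSpace ℝ (Fin 3)) (F := EuclideanSpace ℂ (Fin 3)) 2
    (EuclideanSpace.basisFun (Fin 3) ℝ)
  obtain ⟨KD, hKD⟩ := exists_tsum_le_sqrt_mul_sqrt
  set b : OrthonormalBasis (Fin 3) ℝ (EuclideanSpace ℝ (Fin 3)) := EuclideanSpace.basisFun (Fin 3) ℝ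
    with hb
  -- the constant
  set K₀ : ℝ≥0∞ := (KD : ℝ≥0∞) * (CA : ℝ≥0∞) ^ (1 / 2 : ℝ) *
    (3 * ((CB : ℝ≥0∞) * CA)) ^ (1 / 2 : ℝ) with hK₀
  have hK₀top : K₀ ≠ ⊤ :=
    ENNReal.mul_ne_top (ENNReal.mul_ne_top ENNReal.coe_ne_top
      (ENNReal.rpow_ne_top_of_nonneg (by norm_num) ENNReal.coe_ne_top))
      (ENNReal.rpow_ne_top_of_nonneg (by norm_num) (ENNReal.mul_ne_top ENNReal.ofNat_ne_top
        (ENNReal.mul_ne_top ENNReal.coe_ne_top ENNReal.coe_ne_top)))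
  refine ⟨K₀.toNNReal + 1, fun f W hf hf2 hW => ?_⟩
  have hK : ((K₀.toNNReal + 1 : ℝ≥0) : ℝ≥0∞) = K₀ + 1 := by
    rw [ENNReal.coe_add, ENNReal.coe_toNNReal hK₀top, ENNReal.coe_one]
  rw [hK]
  set A : ℝ≥0∞ := eLpNorm f 2 volume with hA
  set B : ℝ≥0∞ := eLpNorm (fderiv ℝ f) 2 volume with hB
  -- `W` is the `L²` class of `complexify ∘ f`
  set g : Lp (EuclideanSpace ℂ (Fin 3)) 2 (volume : Measure (EuclideanSpace ℝ (Fin 3))) :=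
    (memLp_complexify_comp hf2).toLp _ with hg
  have hWg : W = (g : 𝓢'(EuclideanSpace ℝ (Fin 3), EuclideanSpace ℂ (Fin 3))) :=
    hW.unique (isDistributionOf_toTemperedDistribution hf2)
  have hgA : eLpNorm (g : EuclideanSpace ℝ (Fin 3) → EuclideanSpace ℂ (Fin 3)) 2 volume = A := by
    rw [hg, eLpNorm_congr_ae (MemLp.coeFn_toLp _)]
    exact eLpNorm_congr_norm_ae (Eventually.of_forall fun x => FunctionSpaces.EuclideanSpace.norm_complexify _)
  have hWA : FunctionSpaces.eLpNormDistrib 2 W = A := by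
    rw [hWg, FunctionSpaces.eLpNormDistrib_coe, Lp.enorm_def, hgA]
  -- the degenerate case `Df ∉ L²`
  rcases eq_or_ne B ⊤ with hBtop | hBtop
  · rcases eq_or_ne A 0 with hA0 | hA0
    · -- `f = 0` a.e., so `W = 0`
      have hg0 : g = 0 := by
        rw [Lp.eq_zero_iff_ae_eq_zero]
        exact (eLpNorm_eq_zero_iff (Lp.aestronglyMeasurable g) two_ne_zero).1 (hgA.trans hA0)
      have hW0 : W = 0 := by
        rw [hWg, hg0, ← Lp.toTemperedDistributionCLM_apply, map_zero]
      rw [hW0, FunctionSpaces.eHomBesovNorm_zero]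
      exact zero_le
    · have hA2 : A ^ (1 / 2 : ℝ) ≠ 0 := fun h => by
        rcases ENNReal.rpow_eq_zero_iff.1 h with ⟨h, -⟩ | ⟨-, h⟩
        · exact hA0 h
        · norm_num at h
      rw [hBtop, ENNReal.top_rpow_of_pos (by norm_num),
        ENNReal.mul_top (mul_ne_zero (by simp) hA2)]
      exact le_top
  -- the main case: `Df ∈ L²`, the partial derivatives are `L²` fields with distributions `∂_i W`
  have hcont : Continuous (fderiv ℝ f) := hf.continuous_fderiv one_ne_zero
  have hDf : MemLp (fderiv ℝ f) 2 volume := ⟨hcont.aestronglyMeasurable, hBtop.lt_top⟩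
  have hptw : ∀ (i : Fin 3) (x : EuclideanSpace ℝ (Fin 3)), ‖fderiv ℝ f x (b i)‖ ≤ ‖fderiv ℝ f x‖ :=
    fun i x => by simpa [b.orthonormal.1 i] using (fderiv ℝ f x).le_opNorm (b i)
  have hfi : ∀ i : Fin 3, MemLp (fun x => fderiv ℝ f x (b i)) 2 volume := fun i =>
    MemLp.of_le hDf (hcont.clm_apply continuous_const).aestronglyMeasurable
      (Eventually.of_forall fun x => hptw i x)
  have hWi : ∀ i : Fin 3, IsDistributionOf (fun x => fderiv ℝ f x (b i)) (∂_{b i} W) := fun i =>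
    hW.lineDeriv hf hf2 (b i) (hfi i)
  have hWiB : ∀ i : Fin 3, FunctionSpaces.eLpNormDistrib 2 (∂_{b i} W) ≤ B := fun i => by
    rw [(hWi i).unique (isDistributionOf_toTemperedDistribution (hfi i)), FunctionSpaces.eLpNormDistrib_coe,
      Lp.enorm_def, eLpNorm_congr_ae (MemLp.coeFn_toLp _)]
    calc eLpNorm (fun x => FunctionSpaces.EuclideanSpace.complexify (fderiv ℝ f x (b i))) 2 volume
        = eLpNorm (fun x => fderiv ℝ f x (b i)) 2 volume :=
          eLpNorm_congr_norm_ae (Eventually.of_forall fun x => FunctionSpaces.EuclideanSpace.norm_complexify _)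
      _ ≤ B := eLpNorm_mono fun x => hptw i x
  -- the two bounds on the weights `2^{j/2} ‖Δ̇_j W‖_{L²}`
  have w1 : ∀ j : ℤ, FunctionSpaces.lpBlockWeight (1 / 2) 2 W j ≤ (2 : ℝ≥0∞) ^ ((j : ℝ) / 2) * (CA * A) := by
    intro j
    rw [FunctionSpaces.lpBlockWeight, mul_one_div, ← hWA]
    gcongr
    exact hCA j W
  have w2 : ∀ j : ℤ, FunctionSpaces.lpBlockWeight (1 / 2) 2 W j ≤
      (2 : ℝ≥0∞) ^ (-((j : ℝ) / 2)) * (3 * ((CB : ℝ≥0∞) * CA) * B) := by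
    intro j
    have hsum : ∑ i, FunctionSpaces.eLpNormDistrib 2 (FunctionSpaces.lpBlock j (∂_{b i} W)) ≤ 3 * (CA * B) := by
      calc ∑ i, FunctionSpaces.eLpNormDistrib 2 (FunctionSpaces.lpBlock j (∂_{b i} W)) ≤ ∑ _i : Fin 3, (CA : ℝ≥0∞) * B :=
            Finset.sum_le_sum fun i _ => (hCA j _).trans (by gcongr; exact hWiB i)
        _ = 3 * (CA * B) := by
            rw [Finset.sum_const, Finset.card_univ, Fintype.card_fin, nsmul_eq_mul]
            push_cast
            ring
    rw [FunctionSpaces.lpBlockWeight]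
    calc (2 : ℝ≥0∞) ^ ((j : ℝ) * (1 / 2)) * FunctionSpaces.eLpNormDistrib 2 (FunctionSpaces.lpBlock j W)
        ≤ (2 : ℝ≥0∞) ^ ((j : ℝ) * (1 / 2)) *
            (CB * (2 : ℝ≥0∞) ^ (-(j : ℝ)) * ∑ i, FunctionSpaces.eLpNormDistrib 2 (FunctionSpaces.lpBlock j (∂_{b i} W))) := by
          gcongr
          exact hCB j W
      _ ≤ (2 : ℝ≥0∞) ^ ((j : ℝ) * (1 / 2)) * (CB * (2 : ℝ≥0∞) ^ (-(j : ℝ)) * (3 * (CA * B))) := by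
          gcongr
      _ = (2 : ℝ≥0∞) ^ ((j : ℝ) * (1 / 2)) * (2 : ℝ≥0∞) ^ (-(j : ℝ)) *
            (3 * ((CB : ℝ≥0∞) * CA) * B) := by ring
      _ = (2 : ℝ≥0∞) ^ (-((j : ℝ) / 2)) * (3 * ((CB : ℝ≥0∞) * CA) * B) := by
          rw [FunctionSpaces.two_rpow_mul_two_rpow, show (j : ℝ) * (1 / 2) + -(j : ℝ) = -((j : ℝ) / 2) by ring]
  -- the `ℓ¹` sum
  have hq1 : FunctionSpaces.eHomBesovNorm (1 / 2) 2 1 W = ∑' j, FunctionSpaces.lpBlockWeight (1 / 2) 2 W j := by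
    rw [FunctionSpaces.eHomBesovNorm_eq_tsum_rpow_holds one_ne_zero ENNReal.one_ne_top]
    simp only [ENNReal.toReal_one, ENNReal.rpow_one, div_one]
  rw [hq1]
  have hhalf : (0 : ℝ) ≤ 1 / 2 := by norm_num
  calc ∑' j, FunctionSpaces.lpBlockWeight (1 / 2) 2 W j
      ≤ KD * (CA * A) ^ (1 / 2 : ℝ) * (3 * ((CB : ℝ≥0∞) * CA) * B) ^ (1 / 2 : ℝ) :=
        hKD _ _ _ w1 w2
    _ = K₀ * A ^ (1 / 2 : ℝ) * B ^ (1 / 2 : ℝ) := by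
        rw [hK₀, ENNReal.mul_rpow_of_nonneg _ _ hhalf, ENNReal.mul_rpow_of_nonneg _ B hhalf]
        ring
    _ ≤ (K₀ + 1) * A ^ (1 / 2 : ℝ) * B ^ (1 / 2 : ℝ) := by
        gcongr
        exact le_self_add

/-- **Discharge of `eHomBesovNorm_le_of_sobolev_one`** (`H¹(ℝ³) ⊂ Ḃ^{-1+3/p}_{p,q}(ℝ³)`
multiplicatively, `2 ≤ p < ∞`, `2 ≤ q`; BCD Lemma 2.1 + Prop. 2.20 + Prop. 1.32): the Besov
embedding `Ḃ^{1/2}_{2,q} ↪ Ḃ^{1/2 - 3(1/2 - 1/p)}_{p,q} = Ḃ^{-1+3/p}_{p,q}` (the discharged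
`Literature.Analysis.FunctionSpaces.besov_embedding_holds`, BCD Prop. 2.20), monotonicity in the third index
`‖·‖_{Ḃ^{1/2}_{2,q}} ≤ ‖·‖_{Ḃ^{1/2}_{2,1}}` (`Literature.Analysis.FluidPDE.eHomBesovNorm_exponent_antitone`), and the
multiplicative bound `‖W‖_{Ḃ^{1/2}_{2,1}} ≤ K ‖f‖_{L²}^{1/2} ‖Df‖_{L²}^{1/2}`
(`exists_eHomBesovNorm_half_le_sqrt_mul_sqrt`; Danchin 2018, Prop. 2.1 and §2.1 p. 4).
[cite: BahouriCheminDanchin2011, Lemma 2.1 + Prop. 2.20 + Prop. 1.32] -/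
theorem eHomBesovNorm_le_of_sobolev_one_holds : eHomBesovNorm_le_of_sobolev_one := by
  intro p q _ hp2 hp hq2
  obtain ⟨Ce, hCe⟩ := FunctionSpaces.besov_embedding_holds (E := EuclideanSpace ℝ (Fin 3))
    (F := EuclideanSpace ℂ (Fin 3)) (1 / 2 : ℝ) (p := 2) (r := p) hp2 q
  obtain ⟨K, hK⟩ := exists_eHomBesovNorm_half_le_sqrt_mul_sqrt
  refine ⟨Ce * K, fun f W hf hf2 hW => ?_⟩
  have hptop : p ≠ ⊤ := hp.ne
  have h1 : FunctionSpaces.eHomBesovNorm (-1 + 3 / p.toReal) p q W ≤ Ce * FunctionSpaces.eHomBesovNorm (1 / 2) 2 q W := by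
    convert hCe W using 2
    rw [finrank_euclideanSpace_fin, ENNReal.toReal_ofNat]
    push_cast
    ring
  have hq1 : (1 : ℝ≥0∞) ≤ q := le_trans (by norm_num) hq2
  calc FunctionSpaces.eHomBesovNorm (-1 + 3 / p.toReal) p q W ≤ Ce * FunctionSpaces.eHomBesovNorm (1 / 2) 2 q W := h1
    _ ≤ Ce * FunctionSpaces.eHomBesovNorm (1 / 2) 2 1 W := by
        gcongr
        exact eHomBesovNorm_exponent_antitone _ _ one_ne_zero hq1 W
    _ ≤ Ce * (K * eLpNorm f 2 volume ^ (1 / 2 : ℝ) * eLpNorm (fderiv ℝ f) 2 volume ^ (1 / 2 : ℝ)) := by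
        gcongr
        exact hK hf hf2 hW
    _ = ((Ce * K : ℝ≥0) : ℝ≥0∞) * eLpNorm f 2 volume ^ (1 / 2 : ℝ) *
          eLpNorm (fderiv ℝ f) 2 volume ^ (1 / 2 : ℝ) := by
        push_cast
        ring

end SobolevBesov

end Literature.Analysis.FluidPDE

end
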